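import Mathlib
import Summits.ResolutionOfSingularities.ResolutionOfSingularities.Theorems.WildQuotientsWildQuotientResolutionFiniteModificationBlowupAlgebra
import Literature.AlgebraicGeometry.Resolution.AffineBlowupUniversal
import Literature.AlgebraicGeometry.Resolution.BlowupsLocal
import HarnessLib

/-!
# Finite modifications inside `R[1/t]` are `D(t)`-admissible blow-ups (Abbes–Saito 2011, Prop. 2.16, part 2/2: schemes)
# (crux `WildQuotients.WildQuotientResolution`, stub `stub_phaseZeroHighDim`: first brick of the port of (H1))

Crux stmt-ResolutionOfSingularities-15640 (`WildQuotientResolution`), registered stub `stub_phaseZeroHighDim`.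
After ✓`PrincipalizationReduction.phaseZero_conclusion_of_named` the stub's VERBATIM conclusion follows from
(H1) `Literature.AlgebraicGeometry.Ramification.AbbesSaito2011_inertiaNormalSylow_after_admissibleBlowup`
(Abbes–Saito 2011, Prop. 2.22: a theorem in print, not yet ported) and (H3*) `EquivariantPrincipalization`.
The printed proof of 2.22 (arXiv:1007.3873v3, 2.16–2.22) runs a tower of `U`-admissible blow-ups and
NORMALISATIONS and needs, to present the tower as ONE `U`-admissible blow-up, the following statement
(its Prop. 2.16, there proved with the Rees charts of the blow-up):

> "Let `A` be a ring, `t ∈ A`, `X = Spec(A)`, `U = Spec(A_t)`, `B` a finite sub-`A`-algebra of `A_t` and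
> `Y = Spec(B)`. Assume that `t` is not a zero divisor in `A`. Then the canonical morphism `Y → X` is a
> `U`-admissible blow-up."

This file proves it — in the slightly sharper form "`B ⊆ A_t` generated by finitely many elements
INTEGRAL over `A`" — directly for the tree's blow-ups `IsBlowup` (universal property, Görtz–Wedhorn
Def. 13.90), WITHOUT charts: writing the generators as `fᵢ = aᵢ / tʳ` (`r ≥ 1`) and `J = (tʳ, a₁, …, aₙ)`,

* `J · B = tʳ B` is invertible (`tʳ` is regular in `B ⊆ A_t`);
* KEY ALGEBRA (companion file `…FiniteModificationBlowupAlgebra.lean`, `generator_of_integral_relations`): if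
  `φ : A → S` makes `J S = (u)` invertible, then `φ(tʳ)` is regular and generates `J S` (the cleared integral
  equations of the `fᵢ` force it);
* hence on every scheme `T → Spec A` on which `J` becomes an effective Cartier divisor, `tʳ` is a regular
  global section dividing each `aᵢ` (`appTop_mem_nonZeroDivisors`), the ring map `A → Γ(V)` of each Cartier
  chart extends UNIQUELY to `B` (`exists_ringHom_adjoin`, `ringHom_ext_adjoin` of the companion file), and the
  morphisms `T ⊇ V → Spec B` glue (`isBlowup_adjoin_of_relations`).

Main statements: `isBlowup_adjoin` (generators), `isBlowup_of_fg_of_isIntegral` (a finitely generated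
integral subalgebra `B ⊆ A_t`), `isBlowup_of_finite` (AS 2.16 verbatim: `B` module-finite), each with the
centre `J` finitely generated and `tʳ ∈ J`, `r ≥ 1` (so `V(J) ⊆ V(t)`: the blow-up is `D(t)`-admissible,
`disjoint_basicOpen_support`), and `exists_admissibleBlowup_of_finite` (the tree's admissible-blow-up format:
`IsBlowup` in an ideal sheaf of finite type with support disjoint from `D(t)`, as in the rendering of AS 2.22).

Relation to the tree: for `g : X₃ → X₂` finite between INTEGRAL NOETHERIAN schemes, an isomorphism off an
effective Cartier divisor, ✓`FInjectiveMacaulayfication.FiniteStableBlowup.isBlowup_of_finite_of_stable` with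
✓`…FiniteModificationConductorIdeal.exists_stable_idealSheaf` (route `FrobeniusLadder`, conductor ideals) already
present `g` as a blowing up along a conductor-type ideal sheaf (finitely generated by noetherianity). The present
file is the printed AFFINE statement in Abbes–Saito's generality — ANY commutative ring `A` with `t` regular, `B`
not assumed a domain — with the EXPLICIT finitely generated centre `(tʳ, a₁, …, aₙ)` read off the generators, by
an independent argument (integral equations instead of conductors).

[OURS · crux stmt-ResolutionOfSingularities-15640 · helper toward `stub_phaseZeroHighDim` (first brick of
the port of the named fact (H1) = Abbes–Saito 2011 Prop. 2.22; NOT a proof of the stub); counted 0;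
AI-level work, weaker than expert review.] [cite: AbbesSaito2011, Prop. 2.16]
[cite: GortzWedhorn2020, Def. 13.90]
-/

-- single-problem summit: the doubled namespace component `ResolutionOfSingularities` is forced
set_option linter.dupNamespace false

noncomputable section

open CategoryTheory CategoryTheory.Limits AlgebraicGeometry TopologicalSpace Opposite
open Literature.AlgebraicGeometry.Resolution

namespace Summit.ResolutionOfSingularities.ResolutionOfSingularities.Theorems.WildQuotientResolution.FiniteModificationBlowup

universe u

/-! ## The scheme side: `Spec B → Spec R` is the blow-up of `J = (tʳ, a₁, …, aₙ)` -/

section SchemeSide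

variable {R : Type u} [CommRing R] (t : R) (r : ℕ) {ι : Type u} (a : ι → R) (m : ι → ℕ)
  (q : ι → ℕ → R)
  (hrel : ∀ i, a i ^ m i + ∑ k ∈ Finset.range (m i), q i k * (t ^ r) ^ (m i - k) * a i ^ k = 0)

include hrel in
/-- **On a Cartier chart `V` of a test scheme `T → Spec R`, `tʳ` is regular in `Γ(V, 𝒪_V)` and
divides every `aᵢ`** (`generator_of_integral_relations` through `exists_generator_appTop`). [folklore] -/
theorem chart_regular_and_dvd {T : Scheme.{u}} (g₀ : T ⟶ Spec (.of R)) (V : T.affineOpens)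
    (u : Γ(T, V)) (hu : u ∈ nonZeroDivisors Γ(T, V))
    (hK : ((affineBlowup.idealSheaf (Ideal.span (insert (t ^ r) (Set.range a)))).comap g₀).ideal V =
      Ideal.span {u}) :
    (((V : T.Opens).ι ≫ g₀).appTop.hom.comp (Scheme.ΓSpecIso (.of R)).inv.hom) (t ^ r) ∈
        nonZeroDivisors Γ((V : Scheme.{u}), ⊤) ∧
      ∀ i, ∃ g : Γ((V : Scheme.{u}), ⊤),
        (((V : T.Opens).ι ≫ g₀).appTop.hom.comp (Scheme.ΓSpecIso (.of R)).inv.hom) (t ^ r) * g =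
          (((V : T.Opens).ι ≫ g₀).appTop.hom.comp (Scheme.ΓSpecIso (.of R)).inv.hom) (a i) := by
  obtain ⟨u', hu', hJ⟩ :=
    exists_generator_appTop (Ideal.span (insert (t ^ r) (Set.range a))) g₀ V u hu hK
  obtain ⟨h1, -, h3⟩ := generator_of_integral_relations _ t r a m q hrel hu' hJ
  exact ⟨h1, h3⟩

include hrel in
/-- **`tʳ` is a regular global section of every test scheme** `T → Spec R` on which `J` becomes an
effective Cartier divisor (regular on the Cartier charts, and a section killed on an open cover is
zero). [folklore] -/
theorem appTop_mem_nonZeroDivisors {T : Scheme.{u}} (g₀ : T ⟶ Spec (.of R))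
    (hg₀ : IsEffectiveCartier
      ((affineBlowup.idealSheaf (Ideal.span (insert (t ^ r) (Set.range a)))).comap g₀)) :
    (g₀.appTop.hom.comp (Scheme.ΓSpecIso (.of R)).inv.hom) (t ^ r) ∈ nonZeroDivisors Γ(T, ⊤) := by
  refine mem_nonZeroDivisors_iff_right.mpr fun s hs => ?_
  have hcharts := hg₀
  choose V hxV u hu hKV using hcharts
  have hcover : ⨆ x, (V x : T.Opens) = ⊤ :=
    top_le_iff.mp fun x _ => Opens.mem_iSup.mpr ⟨x, hxV x⟩
  let 𝒱 := T.openCoverOfIsOpenCover (fun x => (V x : T.Opens)) (.mk hcover)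
  refine Scheme.zero_of_zero_cover s 𝒱 fun x => ?_
  obtain ⟨hreg, -⟩ := chart_regular_and_dvd t r a m q hrel g₀ (V x) (u x) (hu x) (hKV x)
  refine mem_nonZeroDivisors_iff_right.mp hreg _ ?_
  have hs' : s * g₀.appTop.hom ((Scheme.ΓSpecIso (.of R)).inv.hom (t ^ r)) = 0 := hs
  change ((V x : T.Opens).ι.appTop).hom s *
    ((V x : T.Opens).ι.appTop).hom (g₀.appTop.hom ((Scheme.ΓSpecIso (.of R)).inv.hom (t ^ r))) = 0
  rw [← map_mul, hs', map_zero]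

include hrel in
/-- **AS 2.16 from cleared relations.** For `s ⊆ R[1/t]` with `x tʳ = a_x ∈ R` (`r ≥ 1`) and cleared
integral equations for the `a_x`, the morphism `Spec R[s] → Spec R` is the blow-up of `Spec R` in
`J = (tʳ, (a_x)_x)` in the sense of the universal property (`IsBlowup`): `J R[s] = (tʳ)` is invertible;
on a test scheme making `J` Cartier, `R → Γ` extends uniquely to `R[s]` chart by chart, and the chart
morphisms glue. [cite: AbbesSaito2011, Prop. 2.16] [cite: GortzWedhorn2020, Def. 13.90] -/
theorem isBlowup_adjoin_of_relations (hr : 0 < r) (s : Set (Localization.Away t)) (e : ι ≃ s)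
    (hfa : ∀ i, ((e i : s) : Localization.Away t) * algebraMap R _ (t ^ r) = algebraMap R _ (a i)) :
    IsBlowup (Spec.map (CommRingCat.ofHom (algebraMap R (Algebra.adjoin R s))))
      (affineBlowup.idealSheaf (Ideal.span (insert (t ^ r) (Set.range a)))) := by
  -- reindex by `s`
  let a' : s → R := fun x => a (e.symm x)
  have hfa' : ∀ x : s, (x : Localization.Away t) * algebraMap R _ (t ^ r) = algebraMap R _ (a' x) := by
    intro x; simpa using hfa (e.symm x)
  have hxs : ∀ x : s, (x : Localization.Away t) ∈ Algebra.adjoin R s :=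
    fun x => Algebra.subset_adjoin x.2
  -- (F2) `J · R[s] = (tʳ)`
  have hJB : (Ideal.span (insert (t ^ r) (Set.range a))).map (algebraMap R (Algebra.adjoin R s)) =
      Ideal.span {algebraMap R (Algebra.adjoin R s) (t ^ r)} := by
    apply le_antisymm
    · rw [Ideal.map_span]
      refine Ideal.span_le.mpr ?_
      rintro _ ⟨x, hx, rfl⟩
      rcases hx with rfl | ⟨i, rfl⟩
      · exact Ideal.mem_span_singleton_self _
      · have : algebraMap R (Algebra.adjoin R s) (a i) =
            ⟨(e i : s), hxs (e i)⟩ * algebraMap R (Algebra.adjoin R s) (t ^ r) :=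
          (Subtype.ext (hfa i)).symm
        rw [SetLike.mem_coe, this]
        exact Ideal.mul_mem_left _ _ (Ideal.mem_span_singleton_self _)
    · rw [Ideal.span_singleton_le_iff_mem]
      exact Ideal.mem_map_of_mem _ (Ideal.subset_span (Set.mem_insert _ _))
  -- (F3) `tʳ` is regular in `R[s] ⊆ R[1/t]`
  have hregB : algebraMap R (Algebra.adjoin R s) (t ^ r) ∈ nonZeroDivisors (Algebra.adjoin R s) := by
    refine mem_nonZeroDivisors_iff_right.mpr fun x hx => ?_
    have hu : IsUnit (algebraMap R (Localization.Away t) (t ^ r)) := by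
      rw [map_pow]; exact (IsLocalization.Away.algebraMap_isUnit t).pow r
    have h1 : (x : Localization.Away t) * algebraMap R (Localization.Away t) (t ^ r) = 0 :=
      congrArg Subtype.val hx
    exact Subtype.ext (hu.mul_left_eq_zero.mp h1)
  -- `Spec B → Spec R` on global sections
  have hnat : (Spec.map (CommRingCat.ofHom (algebraMap R (Algebra.adjoin R s)))).appTop.hom.comp
      (Scheme.ΓSpecIso (.of R)).inv.hom =
      (Scheme.ΓSpecIso (.of (Algebra.adjoin R s))).inv.hom.comp (algebraMap R (Algebra.adjoin R s)) := by
    have h := congrArg CommRingCat.Hom.hom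
      (Scheme.ΓSpecIso_inv_naturality (CommRingCat.ofHom (algebraMap R (Algebra.adjoin R s))))
    rw [CommRingCat.hom_comp, CommRingCat.hom_comp] at h
    exact h.symm
  -- uniqueness of morphisms to `Spec B` over `Spec R` from Cartier test schemes
  have uniq : ∀ {T : Scheme.{u}} (q' : T ⟶ Spec (.of R)),
      IsEffectiveCartier
        ((affineBlowup.idealSheaf (Ideal.span (insert (t ^ r) (Set.range a)))).comap q') →
      ∀ g₁ g₂ : T ⟶ Spec (.of (Algebra.adjoin R s)),
        g₁ ≫ Spec.map (CommRingCat.ofHom (algebraMap R (Algebra.adjoin R s))) = q' →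
        g₂ ≫ Spec.map (CommRingCat.ofHom (algebraMap R (Algebra.adjoin R s))) = q' → g₁ = g₂ := by
    intro T q' hq' g₁ g₂ h₁ h₂
    have hreg := appTop_mem_nonZeroDivisors t r a m q hrel q' hq'
    have key : ∀ g : T ⟶ Spec (.of (Algebra.adjoin R s)),
        g ≫ Spec.map (CommRingCat.ofHom (algebraMap R (Algebra.adjoin R s))) = q' →
        ((Scheme.ΓSpecIso (.of (Algebra.adjoin R s))).inv ≫ g.appTop).hom.comp
            (algebraMap R (Algebra.adjoin R s)) =
          q'.appTop.hom.comp (Scheme.ΓSpecIso (.of R)).inv.hom := by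
      intro g hg
      subst hg
      ext x
      have h := congrArg (fun φ : CommRingCat.of R ⟶ _ => φ.hom x)
        (Scheme.ΓSpecIso_inv_naturality (CommRingCat.ofHom (algebraMap R (Algebra.adjoin R s))))
      simp only [CommRingCat.hom_comp, RingHom.comp_apply, CommRingCat.hom_ofHom] at h
      simp only [CommRingCat.hom_comp, RingHom.comp_apply]
      rw [h, Scheme.Hom.comp_appTop, CommRingCat.comp_apply]
    rw [eq_toSpecΓ_SpecMap g₁, eq_toSpecΓ_SpecMap g₂]
    congr 2
    apply CommRingCat.hom_ext
    exact ringHom_ext_adjoin _ t r hreg s a' hfa' _ _ (key g₁ h₁) (key g₂ h₂)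
  constructor
  · -- `J · 𝒪_{Spec B}` is the effective Cartier divisor `(tʳ)`
    intro y
    refine ⟨⟨⊤, isAffineOpen_top _⟩, Opens.mem_top _,
      (Scheme.ΓSpecIso (.of (Algebra.adjoin R s))).inv.hom (algebraMap R _ (t ^ r)), ?_, ?_⟩
    · exact mem_nonZeroDivisors_of_inverse (Scheme.ΓSpecIso (.of (Algebra.adjoin R s))).inv.hom
        (Scheme.ΓSpecIso (.of (Algebra.adjoin R s))).hom.hom
        (fun b => by rw [← CommRingCat.comp_apply, Iso.inv_hom_id]; rfl)
        (fun b => by rw [← CommRingCat.comp_apply, Iso.hom_inv_id]; rfl) hregB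
    · rw [affineBlowup.idealSheaf, comap_ofIdealTop_of_isAffine, ideal_ofIdealTop_top, Ideal.map_map,
        hnat, ← Ideal.map_map, hJB, Ideal.map_span, Set.image_singleton]
  · -- universality
    intro W g₀ hg₀
    have hcharts := hg₀
    choose V hxV u hu hKV using hcharts
    -- local ring maps `B → Γ(V_x)` and local morphisms `V_x → Spec B`
    have hloc : ∀ x, ∃ ψ : Algebra.adjoin R s →+* Γ((V x : Scheme.{u}), ⊤),
        ψ.comp (algebraMap R _) =
          ((V x : W.Opens).ι ≫ g₀).appTop.hom.comp (Scheme.ΓSpecIso (.of R)).inv.hom := by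
      intro x
      obtain ⟨hreg, hdvd⟩ := chart_regular_and_dvd t r a m q hrel g₀ (V x) (u x) (hu x) (hKV x)
      choose g hg using hdvd
      have hφt : (((V x : W.Opens).ι ≫ g₀).appTop.hom.comp (Scheme.ΓSpecIso (.of R)).inv.hom) t ∈
          nonZeroDivisors _ :=
        mem_nonZeroDivisors_of_pow_mem hr (by rwa [← map_pow])
      obtain ⟨ψ, hψ, -⟩ := exists_ringHom_adjoin _ t hφt s a' r hfa' (fun x' => g (e.symm x'))
        (fun x' => hg (e.symm x'))
      exact ⟨ψ, hψ⟩
    choose ψ hψ using hloc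
    let gl : ∀ x, ((V x : W.Opens) : Scheme.{u}) ⟶ Spec (.of (Algebra.adjoin R s)) := fun x =>
      ((V x : W.Opens) : Scheme.{u}).toSpecΓ ≫ Spec.map (CommRingCat.ofHom (ψ x))
    have hglπ : ∀ x, gl x ≫ Spec.map (CommRingCat.ofHom (algebraMap R (Algebra.adjoin R s))) =
        (V x : W.Opens).ι ≫ g₀ := by
      intro x
      rw [eq_toSpecΓ_SpecMap ((V x : W.Opens).ι ≫ g₀)]
      change ((V x : W.Opens) : Scheme.{u}).toSpecΓ ≫ Spec.map (CommRingCat.ofHom (ψ x)) ≫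
        Spec.map (CommRingCat.ofHom (algebraMap R (Algebra.adjoin R s))) = _
      rw [← Spec.map_comp]
      congr 2
      apply CommRingCat.hom_ext
      rw [CommRingCat.hom_comp, CommRingCat.hom_comp]
      exact hψ x
    -- compatibility on overlaps and gluing
    have hcover : ⨆ x, (V x : W.Opens) = ⊤ :=
      top_le_iff.mp fun x _ => Opens.mem_iSup.mpr ⟨x, hxV x⟩
    let 𝒱 := W.openCoverOfIsOpenCover (fun x => (V x : W.Opens)) (.mk hcover)
    have hcompat : ∀ x y : W,
        pullback.fst ((V x : W.Opens).ι) ((V y : W.Opens).ι) ≫ gl x = pullback.snd _ _ ≫ gl y := by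
      intro x y
      refine uniq (pullback.fst ((V x : W.Opens).ι) ((V y : W.Opens).ι) ≫ (V x : W.Opens).ι ≫ g₀)
        ?_ _ _ ?_ ?_
      · rw [← Category.assoc, Scheme.IdealSheafData.comap_comp]
        exact hg₀.comap_of_isOpenImmersion _
      · rw [Category.assoc, hglπ]
      · rw [Category.assoc, hglπ, ← Category.assoc, ← pullback.condition, Category.assoc]
    have hGπ : 𝒱.glueMorphisms gl hcompat ≫
        Spec.map (CommRingCat.ofHom (algebraMap R (Algebra.adjoin R s))) = g₀ := by
      apply Scheme.Cover.hom_ext 𝒱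
      intro x
      change (V x : W.Opens).ι ≫ 𝒱.glueMorphisms gl hcompat ≫ _ = (V x : W.Opens).ι ≫ g₀
      rw [← Category.assoc]
      have : (V x : W.Opens).ι ≫ 𝒱.glueMorphisms gl hcompat = gl x :=
        Scheme.Cover.ι_glueMorphisms 𝒱 gl hcompat x
      rw [this, hglπ]
    exact ⟨𝒱.glueMorphisms gl hcompat, hGπ, fun g' hg' => uniq g₀ hg₀ _ _ hg' hGπ⟩

end SchemeSide

/-! ## Abbes–Saito 2011, Prop. 2.16 -/

/-- `D(t)`-admissibility of the centre: if `tʳ ∈ J` then `V(J) ∩ D(t) = ∅` on `Spec R`. [folklore] -/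
theorem disjoint_basicOpen_support {R : Type u} [CommRing R] (t : R) {r : ℕ} {J : Ideal R}
    (hJ : t ^ r ∈ J) :
    Disjoint ((PrimeSpectrum.basicOpen t : TopologicalSpace.Opens (PrimeSpectrum R)) :
        Set (PrimeSpectrum R))
      ((affineBlowup.idealSheaf J).support : Set (Spec (.of R))) := by
  rw [affineBlowup.support_idealSheaf, Set.disjoint_left]
  intro x hx hx'
  rw [SetLike.mem_coe, PrimeSpectrum.mem_basicOpen] at hx
  exact hx (x.isPrime.mem_of_pow_mem r ((PrimeSpectrum.mem_zeroLocus _ _).mp hx' hJ))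

/-- **AS 2.16 for finitely many integral generators.** `t` regular in `R`, `s ⊆ R[1/t]` finite with
every element integral over `R`: there are `r ≥ 1` and `a : s → R` with `x tʳ = a_x` such that
`Spec R[s] → Spec R` is the blow-up of `Spec R` in `J = (tʳ, (a_x)_{x ∈ s})` — a finitely generated
ideal containing `tʳ`, so the blow-up is `D(t)`-admissible (`disjoint_basicOpen_support`).
[cite: AbbesSaito2011, Prop. 2.16] -/
theorem isBlowup_adjoin {R : Type u} [CommRing R] (t : R) (ht : t ∈ nonZeroDivisors R)
    (s : Set (Localization.Away t)) (hs : s.Finite) (hint : ∀ x ∈ s, IsIntegral R x) :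
    ∃ (r : ℕ) (a : s → R), 0 < r ∧
      (∀ x : s, (x : Localization.Away t) * algebraMap R _ (t ^ r) = algebraMap R _ (a x)) ∧
      IsBlowup (Spec.map (CommRingCat.ofHom (algebraMap R (Algebra.adjoin R s))))
        (affineBlowup.idealSheaf (Ideal.span (insert (t ^ r) (Set.range a)))) := by
  haveI : Finite s := hs.to_subtype
  obtain ⟨r, a, m, q, hr, hfa, hrel⟩ := exists_common_denominator_relations t ht
    (Subtype.val : s → Localization.Away t) fun x => hint x.1 x.2
  exact ⟨r, a, hr, hfa, isBlowup_adjoin_of_relations t r a m q hrel hr s (Equiv.refl s) hfa⟩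

/-- **AS 2.16 for a finitely generated integral subalgebra `B ⊆ R[1/t]`** (`t` regular): `Spec B → Spec R`
is the blow-up of a finitely generated ideal `J ∋ tʳ` (`r ≥ 1`), i.e. a `D(t)`-admissible blow-up.
[cite: AbbesSaito2011, Prop. 2.16] -/
theorem isBlowup_of_fg_of_isIntegral {R : Type u} [CommRing R] (t : R) (ht : t ∈ nonZeroDivisors R)
    (B : Subalgebra R (Localization.Away t)) (hB : B.FG) (hint : ∀ b ∈ B, IsIntegral R b) :
    ∃ (J : Ideal R) (r : ℕ), J.FG ∧ 0 < r ∧ t ^ r ∈ J ∧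
      IsBlowup (Spec.map (CommRingCat.ofHom (algebraMap R B))) (affineBlowup.idealSheaf J) := by
  obtain ⟨s₀, rfl⟩ := hB
  obtain ⟨r, a, hr, -, hbl⟩ := isBlowup_adjoin t ht (s₀ : Set (Localization.Away t)) s₀.finite_toSet
    fun x hx => hint x (Algebra.subset_adjoin hx)
  refine ⟨Ideal.span (insert (t ^ r) (Set.range a)), r, ?_, hr,
    Ideal.subset_span (Set.mem_insert _ _), hbl⟩
  exact Submodule.fg_def.mpr ⟨_, (Set.finite_range a).insert (t ^ r), rfl⟩

/-- **Abbes–Saito 2011, Prop. 2.16** ("Let `A` be a ring, `t ∈ A`, `X = Spec(A)`, `U = Spec(A_t)`, `B` a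
finite sub-`A`-algebra of `A_t` and `Y = Spec(B)`. Assume that `t` is not a zero divisor in `A`. Then the
canonical morphism `Y → X` is a `U`-admissible blow-up."), rendered: for `t` regular in `R` and a
module-finite subalgebra `B ⊆ R[1/t]`, `Spec B → Spec R` is the blow-up (`IsBlowup`, universal property)
of `Spec R` in a finitely generated ideal `J` with `tʳ ∈ J` for some `r ≥ 1` (so `V(J) ⊆ V(t)` and the
blow-up is `D(t)`-admissible, `disjoint_basicOpen_support`). [cite: AbbesSaito2011, Prop. 2.16]
[cite: StacksProject, Tag 080K] -/
theorem isBlowup_of_finite {R : Type u} [CommRing R] (t : R) (ht : t ∈ nonZeroDivisors R)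
    (B : Subalgebra R (Localization.Away t)) [Module.Finite R B] :
    ∃ (J : Ideal R) (r : ℕ), J.FG ∧ 0 < r ∧ t ^ r ∈ J ∧
      IsBlowup (Spec.map (CommRingCat.ofHom (algebraMap R B))) (affineBlowup.idealSheaf J) := by
  refine isBlowup_of_fg_of_isIntegral t ht B ?_ fun b hb => ?_
  · exact B.fg_of_fg_toSubmodule ((Submodule.fg_top (N := Subalgebra.toSubmodule B)).mp
      Module.Finite.fg_top)
  · exact (Algebra.IsIntegral.isIntegral (R := R) (⟨b, hb⟩ : B)).map B.val


/-- **AS 2.16 in the tree's admissible-blow-up format** (as in the rendering of Abbes–Saito 2.22,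
`Literature.AlgebraicGeometry.Ramification.AbbesSaito2011_inertiaNormalSylow_after_admissibleBlowup`: a blowing up
`IsBlowup` in an ideal sheaf OF FINITE TYPE whose support is DISJOINT from `U`): for `t` regular in `R` and a
module-finite subalgebra `B ⊆ R[1/t]`, `Spec B → Spec R` is a `D(t)`-admissible blow-up.
[cite: AbbesSaito2011, Prop. 2.16] [cite: StacksProject, Tag 080K] -/
theorem exists_admissibleBlowup_of_finite {R : Type u} [CommRing R] (t : R) (ht : t ∈ nonZeroDivisors R)
    (B : Subalgebra R (Localization.Away t)) [Module.Finite R B] :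
    ∃ I : (Spec (.of R)).IdealSheafData,
      IsBlowup (Spec.map (CommRingCat.ofHom (algebraMap R B))) I ∧
      (∀ W : (Spec (.of R)).affineOpens, (I.ideal W).FG) ∧
      Disjoint ((PrimeSpectrum.basicOpen t : TopologicalSpace.Opens (PrimeSpectrum R)) :
          Set (PrimeSpectrum R)) (I.support : Set (Spec (.of R))) := by
  obtain ⟨J, r, hJ, -, htJ, hbl⟩ := isBlowup_of_finite t ht B
  refine ⟨affineBlowup.idealSheaf J, hbl, fun W => ?_, disjoint_basicOpen_support t htJ⟩
  rw [affineBlowup.idealSheaf, Scheme.IdealSheafData.ofIdealTop_ideal]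
  exact (hJ.map _).map _

end Summit.ResolutionOfSingularities.ResolutionOfSingularities.Theorems.WildQuotientResolution.FiniteModificationBlowup

end
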